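import Summits.AtomisticToContinuum.HydrodynamicLimit.Theorems.RelayRaceLocalityNearConstantShortTimeHLTiltL2Defs
import Summits.AtomisticToContinuum.HydrodynamicLimit.Theorems.RelayRaceLocalityNearConstantShortTimeHLGeneralFamilyConcentrationContraction
import HarnessLib

/-!
# Crux `NearConstantShortTimeHL` (stmt-AtomisticToContinuum-12502), line `small-tilt-domination`:
# convergence of the insertion ratios with a rate (`tl_ratioRate : RatioRate`)

At a FIXED pair `(ε, n)` with `n p_ε ≤ λ`, for a profile `P` in the statics regime `SmallDensity P σ` with slack
`ovDensity P σ ≤ λ`, `2eλ ≤ 1/14`, the inverse insertion factors `q(m) = Ξ(m)/Ξ(m+1)` of the canonical dilute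
hard-core gas approach `R = ratioLimit P σ` at an explicit rate: if the head coefficients `C(m,j) W¹(j+1)`, `j ≤ J`,
are `τ`-close to their cluster limits at all levels `m ∈ [m₀, n)` (`J ≤ m₀`), then for `m₀ + kJ ≤ m < n`
`|q(m) - R| ≤ 2 (4κ₊)ᵏ + 4 ((J+1) 2ᴶ τ + 2eθ₊^{J+1}/(1-θ₊)) / (1 - 4κ₊)`, `θ₊ = 2eλ`, `κ₊ = eθ₊/(1-θ₊)²`.

This is the two-scale contraction of `HardSphereEulerRatio` / `gf_tendsto_q_sub` in CLOSED QUANTITATIVE FORM: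
an induction on the number `k` of contraction steps, each step being the tree's deterministic estimate
`gf_abs_inv_q_sub_inv_le` (the ratios entering the step at level `m` live at levels `≥ m - J`) combined with
`|q - R| ≤ 4 |q⁻¹ - R⁻¹|` (`q, R ∈ (0, 2]`), started from the crude bound `|q - R| ≤ 2`
(`q ∈ [1, 2]`, `R ∈ [1/2, 2]`); the affine recursion `η_{k+1} = 4S + 4κ₊ η_k` is solved in closed form.

No definitions. Source: E. Pulvirenti – D. Tsagkarogiannis, Comm. Math. Phys. 316 (2012), §5.
-/

noncomputable section

namespace Summit.AtomisticToContinuum.HydrodynamicLimit.Theorems.NearConstantShortTimeHL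

open MeasureTheory ProbabilityTheory Finset Filter Topology
open scoped ENNReal BigOperators
open Literature.MathematicalPhysics.KineticTheory Literature.MathematicalPhysics.StatisticalMechanics
open Literature.Probability.LatticeModels

section Iteration

variable {P : DensityProfile} {σ lam e : ℝ} {n : ℕ}

/-- **The crude start**: `|Ξ(m)/Ξ(m+1) - R| ≤ 2` for `m < n` (`Ξ(m)/Ξ(m+1) ∈ [1, 2]` when `n p_ε ≤ λ ≤ 1/2`,
`R = ratioLimit P σ ∈ [1/2, 2]`). [folklore] -/
theorem tlr_abs_q_sub_ratioLimit_le_two (hP : SmallDensity P σ) (he : 0 ≤ e) (he2 : e < 1 / 2)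
    (hnp : (n : ℝ) * pOv P e ≤ lam) (hlam1 : lam < 1) (hlam2 : lam ≤ 1 / 2) {m : ℕ} (hm : m < n) :
    |Xi P e n m / Xi P e n (m + 1) - ratioLimit P σ| ≤ 2 := by
  have hq1 := gf_one_le_q he he2 hnp hlam1 hm
  have hq2 := gf_q_le_two he he2 hnp hlam1 hlam2 hm
  have hR1 := hP.ratioLimit_mem.1
  have hR2 := hP.ratioLimit_mem.2
  rw [abs_le]
  constructor <;> linarith

/-- **One contraction step at a fixed scale.** If the head coefficients are `τ`-close to their limits at all
levels `m ∈ [m₀, n)` and `|Ξ(m)/Ξ(m+1) - R| ≤ η` at all levels `m ∈ [M, n)` (`m₀ ≤ M`), then at all levels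
`m ∈ [M + J, n)`: `|Ξ(m)/Ξ(m+1) - R| ≤ 4 ((J+1) 2ᴶ τ + κ₊ η + 2 e θ₊^{J+1}/(1-θ₊))` — the deterministic estimate
`gf_abs_inv_q_sub_inv_le` (whose input ratios at level `m` live at the levels `m-1-i ≥ m - J`, `i < J`) and
`|q - R| ≤ 4 |q⁻¹ - R⁻¹|`. [folklore] -/
theorem tlr_abs_q_sub_ratioLimit_le_step [NeZero n] (hP : SmallDensity P σ) (hlamσ : ovDensity P σ ≤ lam)
    (hlam : 2 * Real.exp 1 * lam ≤ 1 / 14) (he : 0 ≤ e) (he2 : e < 1 / 2) (hnp : (n : ℝ) * pOv P e ≤ lam)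
    {J m₀ : ℕ} {τ : ℝ} (hτ : 0 ≤ τ)
    (hc : ∀ m : ℕ, m₀ ≤ m → m < n → ∀ j ≤ J,
      |(m.choose j : ℝ) * Wd P e n (fun _ => 1) (j + 1) - coefLim P σ (fun _ => 1) j| ≤ τ)
    {M : ℕ} {η : ℝ} (hη : 0 ≤ η) (hM : m₀ ≤ M)
    (H : ∀ m : ℕ, M ≤ m → m < n → |Xi P e n m / Xi P e n (m + 1) - ratioLimit P σ| ≤ η)
    {m : ℕ} (hMJ : M + J ≤ m) (hm : m < n) :
    |Xi P e n m / Xi P e n (m + 1) - ratioLimit P σ| ≤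
      4 * ((J + 1) * 2 ^ J * τ + (Real.exp 1 * (2 * Real.exp 1 * lam) / (1 - 2 * Real.exp 1 * lam) ^ 2) * η +
        2 * (Real.exp 1 * (2 * Real.exp 1 * lam) ^ (J + 1) / (1 - 2 * Real.exp 1 * lam))) := by
  have hlam0 : 0 ≤ lam := gf_lam_nonneg hnp he
  obtain ⟨hθ1, hlam2, -, -⟩ := gf_slack_numerics hlam0 hlam
  have hlam1 : lam < 1 := by linarith
  have hR0 : 0 < ratioLimit P σ := hP.ratioLimit_pos
  have hR2 : ratioLimit P σ ≤ 2 := hP.ratioLimit_mem.2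
  have hq0 : 0 < Xi P e n m / Xi P e n (m + 1) := one_pos.trans_le (gf_one_le_q he he2 hnp hlam1 hm)
  have hq2 : Xi P e n m / Xi P e n (m + 1) ≤ 2 := gf_q_le_two he he2 hnp hlam1 hlam2 hm
  refine (EosUniformGas.abs_sub_le_four_mul_abs_inv_sub_inv hq0 hq2 hR0 hR2).trans ?_
  refine mul_le_mul_of_nonneg_left ?_ (by norm_num)
  exact gf_abs_inv_q_sub_inv_le hP hlamσ hlam he he2 hnp (by omega) hm hη hτ
    (fun i hi => H (m - 1 - i) (by omega) (by omega)) (hc m (by omega) hm)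

end Iteration

/-- **CONVERGENCE OF THE INSERTION RATIOS WITH A RATE** (registered stub `tl_ratioRate` of the line
`small-tilt-domination`): finitely many steps of the two-scale contraction in closed form — after `k` steps, for
`m₀ + kJ ≤ m < n`, `|Ξ(m)/Ξ(m+1) - R| ≤ 2 (4κ₊)ᵏ + 4 ((J+1) 2ᴶ τ + 2eθ₊^{J+1}/(1-θ₊)) / (1 - 4κ₊)`.
Induction on `k`: the crude start `tlr_abs_q_sub_ratioLimit_le_two`, the step `tlr_abs_q_sub_ratioLimit_le_step`,
and the closed-form solution of `η₀ = 2`, `η_{k+1} = 4 ((J+1) 2ᴶ τ + 2eθ₊^{J+1}/(1-θ₊)) + 4κ₊ η_k`.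
[cite: PulvirentiTsagkarogiannis2012, §5] -/
theorem tl_ratioRate : RatioRate := by
  intro P σ lam e n _ hP hlamσ hlam he he2 hnp J m₀ hJm₀ τ hτ hc k
  have hlam0 : 0 ≤ lam := gf_lam_nonneg hnp he
  obtain ⟨hθ1, hlam2, hA1, hκ0⟩ := gf_slack_numerics hlam0 hlam
  have hlam1 : lam < 1 := by linarith
  set θ := 2 * Real.exp 1 * lam with hθdef
  set κ := Real.exp 1 * θ / (1 - θ) ^ 2 with hκdef
  have hθ0 : 0 ≤ θ := by positivity
  have hT0 : 0 ≤ Real.exp 1 * θ ^ (J + 1) / (1 - θ) := div_nonneg (by positivity) (by linarith)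
  have hS0 : 0 ≤ 4 * (((J : ℝ) + 1) * 2 ^ J * τ + 2 * (Real.exp 1 * θ ^ (J + 1) / (1 - θ))) / (1 - 4 * κ) :=
    div_nonneg (by positivity) (by linarith)
  induction k with
  | zero =>
      intro m hm₀ hm
      rw [pow_zero, mul_one]
      have h2 := tlr_abs_q_sub_ratioLimit_le_two hP he he2 hnp hlam1 hlam2 hm
      linarith
  | succ k ih =>
      intro m hm₀ hm
      have hηk : 0 ≤ 2 * (4 * κ) ^ k +
          4 * (((J : ℝ) + 1) * 2 ^ J * τ + 2 * (Real.exp 1 * θ ^ (J + 1) / (1 - θ))) / (1 - 4 * κ) := by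
        positivity
      have hMJ : m₀ + k * J + J ≤ m := by rw [Nat.succ_mul] at hm₀; omega
      refine (tlr_abs_q_sub_ratioLimit_le_step hP hlamσ hlam he he2 hnp hτ hc hηk (Nat.le_add_right m₀ (k * J))
        ih hMJ hm).trans (le_of_eq ?_)
      have h1A : (1 - 4 * κ) ≠ 0 := by linarith
      rw [← hθdef, ← hκdef]
      field_simp
      ring

end Summit.AtomisticToContinuum.HydrodynamicLimit.Theorems.NearConstantShortTimeHL

end
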